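import Literature.AlgebraicGeometry.Motives.HodgeStructureCentralizerRestrictionToRepresentatives
import Literature.AlgebraicGeometry.Motives.HodgeStructureLefschetzGroupInternalBlocks
import HarnessLib

/-!
# RESTRICTION TO THE REPRESENTATIVES IS MILNE'S ISOMORPHISM `S(H)(ℚ) ⥲ Π_k S(T_k)(ℚ)`: for an isotypically labelled irreducible
# decomposition `V = ⊕ᵢ Tᵢ` of a polarized `ℚ`-Hodge structure `(H, ψ)` with representatives `T_k`, `k ∈ κ`, every `g ∈ S(H)(ℚ)`
# preserves each `T_k`, and `g ↦ (g|_{T_k})_k` IS an isomorphism of groups `S(H, ψ)(ℚ) ≃* Π_k S(T_k, ψ|_{T_k})(ℚ)` — Milne's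
# Prop. 1.5 on rational points in CANONICAL form («which is independent of the choice of the isogeny») (Milne 1999 §1 p. 644, Prop. 1.5)

[topic AlgebraicGeometry/Motives]

Layer `Literature/AlgebraicGeometry/Motives`, lane `lit-hodgefound` (Track 2 foundations library; prover seat
`lit-hodgefound-p02`, generation 53, self-proposed row g53-#2). THEOREMS ONLY: no definition, no named fact (net debt `0`),
no instance, no notation.  Sequel, BY NAME (nothing restated), of g53-#1 `Motives/HodgeStructureCentralizerRestrictionToRepresentatives`
(restriction to the representatives `C(H) ≃ₐ[ℚ] Π_k C(T_k)` with `†`, `γ ∘ g = g ∘ γ` between blocks) and g52-#4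
`Motives/HodgeStructureLefschetzGroupInternalBlocks` (`Polarization.exists_monoidHom_pi_lefschetzGroup`: restriction
`S(H)(ℚ) ↪ Π_i S(T_i)(ℚ)` over ALL blocks, with the formula); Milne's `S(A)(k) = {γ ∈ C(A) | γ†γ = 1}` literally is p34's
`Polarization.mem_lefschetzGroup_iff_adjoint_mul_self_eq_one` (`Motives/HodgeStructureLefschetzGroupPoints`).  g52-#6
(`Polarization.nonempty_lefschetzGroup_mulEquiv_pi_of_labelling`) gave Prop. 1.5 over the representatives as an abstract
isomorphism; here it is identified as restriction, «as an immediate consequence of Proposition 1.1» in its canonical form (g53-#1).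

## The source, verbatim

J. S. Milne, *Lefschetz classes on abelian varieties*, Duke Math. J. 96 (1999) 639–675 [Milne1999LefschetzClasses] (held
`paper:doi-10-1215-s0012-7094-99-09620-5`, p. 644 L16–L28): "For an abelian variety `A` over `Ω`, we define `S(A)` to be the
algebraic subgroup of `GL(V(A))` such that, for all commutative `k`-algebras `R`, `S(A)(R) = {γ ∈ C(A) ⊗_k R | γ†γ = 1}`. …
Clearly `S(A)` depends only on the isogeny class of `A` (up to a unique isomorphism). … **Proposition 1.5.** Let `A₁, …, A_s` be a
set of representatives for the simple isogeny factors of `A`, so that there exists an isogeny `A₁^{r₁} × ⋯ × A_s^{r_s} → A` for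
some `rᵢ > 0`. Any such isogeny induces an isomorphism `S(A₁) × ⋯ × S(A_s) → S(A)`, which is independent of the choice of the
isogeny. *Proof.* This is an immediate consequence of Proposition 1.1."  Also H. Lange [Lange2023AbelianVarietiesComplex] §7.2.4
Exercise (4) (the Lefschetz group), B. Moonen [Moonen2004MT] §4 Lemma 4.6.

## Dictionary and what is proved (namespace `Literature.AlgebraicGeometry.Motives.HodgeStructure`)

`S(H)(ℚ) = ψ.lefschetzGroup ≤ GL(V)` (`g` commuting with `E_φ` and preserving `ψ`), `S(T_k)(ℚ) = (ψ.restrict (T k)).lefschetzGroup`;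
`T : ι → SubHodgeStructure H` an internal direct sum with isotypic labelling `c : ι → κ`, `κ ⊆ ι`.

* §1 **`Polarization.exists_monoidHom_pi_lefschetzGroup_of_labelling`** (restriction to the representatives
  `r : S(H)(ℚ) →* Π_{k ∈ κ} S(T_k)(ℚ)`, `(r g)_k v = g v`, is INJECTIVE as soon as `Tᵢ ≅ T_{c i}` for all `i` — `g` commutes with
  the isomorphisms, g53-#1), `Polarization.lefschetzGroup_pi_eq_of_forall_coe_apply_eq` («independent of the choice»: two maps over
  the restrictions coincide).
* §2 **`Polarization.exists_mem_lefschetzGroup_forall_apply_eq_of_labelling`** (GLUING: every family `δ_k ∈ S(T_k)(ℚ)` is the family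
  of restrictions of some `g ∈ S(H)(ℚ)` — the element `γ = e⁻¹(δ) ∈ C(H)` of Prop. 1.1 has `e(γ†γ) = (δ_k†δ_k)_k = 1`, so `γ†γ = 1`
  and `γ ∈ S(H)(ℚ)`: «an immediate consequence of Proposition 1.1»), **`Polarization.exists_mulEquiv_pi_lefschetzGroup_of_labelling`**
  (MILNE'S PROP. 1.5 on `ℚ`-points, canonical form: restriction is an isomorphism `S(H)(ℚ) ≃* Π_k S(T_k)(ℚ)`),
  `Polarization.coe_symm_apply_eq_of_forall_coe_apply_eq` (the inverse glues), `Polarization.existsUnique_mem_lefschetzGroup_forall_apply_eq`.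
-/

noncomputable section

namespace Literature.AlgebraicGeometry.Motives

namespace HodgeStructure

universe u

variable {V : Type u} [AddCommGroup V] [Module ℚ V] {n : ℤ} {H : HodgeStructure V n}

/-! ## §1 Restriction of `S(H)(ℚ)` to the representatives is injective -/

section Any

variable {ι : Type*} {κ : Finset ι} (T : ι → SubHodgeStructure H) (ψ : Polarization H)

/-- **«independent of the choice of the isogeny»** for `S`: two maps `r, r' : S(H)(ℚ) → Π_{k ∈ κ} S(T_k)(ℚ)` both lying over the
restrictions (`(r g)_k v = g v = (r' g)_k v`) COINCIDE. [cite: Milne1999LefschetzClasses, §1 p. 644 L20–L21 and Prop. 1.5] -/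
theorem Polarization.lefschetzGroup_pi_eq_of_forall_coe_apply_eq
    (r r' : ψ.lefschetzGroup → Π k : κ, (ψ.restrict (T k)).lefschetzGroup)
    (hr : ∀ (g : ψ.lefschetzGroup) (k : κ) (v : (T k).toSubmodule),
      ((r g k : (T k).toSubmodule ≃ₗ[ℚ] (T k).toSubmodule) v : V) = (g : V ≃ₗ[ℚ] V) v)
    (hr' : ∀ (g : ψ.lefschetzGroup) (k : κ) (v : (T k).toSubmodule),
      ((r' g k : (T k).toSubmodule ≃ₗ[ℚ] (T k).toSubmodule) v : V) = (g : V ≃ₗ[ℚ] V) v) :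
    r = r' :=
  funext fun g => funext fun k => Subtype.ext (LinearEquiv.ext fun v => Subtype.ext ((hr g k v).trans (hr' g k v).symm))

/-- **The inverse GLUES**: for an equivalence `e : S(H)(ℚ) ≃ Π_{k ∈ κ} S(T_k)(ℚ)` lying over the restrictions, `e⁻¹ δ` restricts to
`δ_k` on each representative `T_k`. [cite: Milne1999LefschetzClasses, §1 Prop. 1.5 (p. 644)] -/
theorem Polarization.coe_symm_apply_eq_of_forall_coe_apply_eq
    (e : ψ.lefschetzGroup ≃* Π k : κ, (ψ.restrict (T k)).lefschetzGroup)
    (he : ∀ (g : ψ.lefschetzGroup) (k : κ) (v : (T k).toSubmodule),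
      ((e g k : (T k).toSubmodule ≃ₗ[ℚ] (T k).toSubmodule) v : V) = (g : V ≃ₗ[ℚ] V) v)
    (δ : Π k : κ, (ψ.restrict (T k)).lefschetzGroup) (k : κ) (v : (T k).toSubmodule) :
    ((e.symm δ : ψ.lefschetzGroup) : V ≃ₗ[ℚ] V) v = ((δ k : (T k).toSubmodule ≃ₗ[ℚ] (T k).toSubmodule) v : V) := by
  rw [← he (e.symm δ) k v, MulEquiv.apply_symm_apply]

end Any

section Labelled

variable {ι : Type*} [Fintype ι] [DecidableEq ι] (T : ι → SubHodgeStructure H)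
  (hT : DirectSum.IsInternal fun i => (T i).toSubmodule) {κ : Finset ι} {c : ι → κ}
  (hc : ∀ i, ∃ g : Hom (T i).toHodgeStructure (T (c i)).toHodgeStructure, Function.Bijective g.toLinearMap)
  (hκ : ∀ k k' : κ, (∃ g : Hom (T k).toHodgeStructure (T k').toHodgeStructure,
    Function.Bijective g.toLinearMap) → k = k')

include hT hc

/-- **RESTRICTION TO THE REPRESENTATIVES `r : S(H)(ℚ) →* Π_{k ∈ κ} S(T_k)(ℚ)`, `(r g)_k v = g v`, is an INJECTIVE group
homomorphism** as soon as every block `Tᵢ` is isomorphic to its representative `T_{c i}` (`S(T_k)(ℚ)` for the restricted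
polarization `ψ|_{T_k}`): if `g` is the identity on every `T_k`, then for an isomorphism `f : Tᵢ ⥲ T_{c i}` and `v ∈ Tᵢ`,
`f (g v) = g (f v) = f v` (g53-#1: `↑g ∈ C(H)` commutes with `f`), so `g|_{Tᵢ} = id` for all `i` and `g = 1`.
[cite: Milne1999LefschetzClasses, §1 p. 644 and Prop. 1.5] [cite: Moonen2004MT, §4 Lemma 4.6] -/
theorem Polarization.exists_monoidHom_pi_lefschetzGroup_of_labelling (ψ : Polarization H) :
    ∃ r : ψ.lefschetzGroup →* Π k : κ, (ψ.restrict (T k)).lefschetzGroup,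
      (∀ (g : ψ.lefschetzGroup) (k : κ) (v : (T k).toSubmodule),
        ((r g k : (T k).toSubmodule ≃ₗ[ℚ] (T k).toSubmodule) v : V) = (g : V ≃ₗ[ℚ] V) v) ∧
      Function.Injective r := by
  obtain ⟨r₀, hr₀, hinj₀⟩ := ψ.exists_monoidHom_pi_lefschetzGroup T hT
  let r : ψ.lefschetzGroup →* Π k : κ, (ψ.restrict (T k)).lefschetzGroup :=
    (MonoidHom.pi fun k : κ => Pi.evalMonoidHom (fun i => (ψ.restrict (T i)).lefschetzGroup) (k : ι)).comp r₀
  have hr : ∀ (g : ψ.lefschetzGroup) (k : κ) (v : (T k).toSubmodule),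
      ((r g k : (T k).toSubmodule ≃ₗ[ℚ] (T k).toSubmodule) v : V) = (g : V ≃ₗ[ℚ] V) v := fun g k v => hr₀ g k v
  refine ⟨r, hr, (injective_iff_map_eq_one r).2 fun g hg => ?_⟩
  -- `↑g ∈ C(H)`, and `g` is the identity on every representative
  have hgC : ((g : V ≃ₗ[ℚ] V) : Module.End ℚ V) ∈ Subalgebra.centralizer ℚ (H.endAlg : Set (Module.End ℚ V)) :=
    (forall_endAlg_apply_iff_coe_mem_centralizer_endAlg H _).1 ((ψ.mem_lefschetzGroup_iff _).1 g.2).1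
  have hone : ∀ (k : κ) (w : (T (k : ι)).toSubmodule), ((g : V ≃ₗ[ℚ] V) : Module.End ℚ V) w = w := fun k w => by
    rw [LinearEquiv.coe_coe, ← hr g k w, hg, Pi.one_apply, OneMemClass.coe_one]
    rfl
  -- hence on every block, hence `g = 1`
  apply hinj₀
  rw [map_one]
  refine funext fun i => Subtype.ext (LinearEquiv.ext fun v => Subtype.ext ?_)
  rw [hr₀, Pi.one_apply, OneMemClass.coe_one]
  change (g : V ≃ₗ[ℚ] V) v = v
  obtain ⟨f, hf⟩ := hc i
  have h1 := coe_hom_apply_eq_of_mem_centralizer_endAlg T hT hgC f v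
  rw [hone (c i)] at h1
  have h2 : v = ⟨((g : V ≃ₗ[ℚ] V) : Module.End ℚ V) v, apply_mem_of_mem_centralizer_endAlg T hT hgC i v.2⟩ :=
    hf.1 (Subtype.ext h1)
  rw [← LinearEquiv.coe_coe]
  exact (congrArg Subtype.val h2).symm

include hκ

variable [Module.Finite ℚ V]

/-- **GLUING — «an immediate consequence of Proposition 1.1»: every family `δ_k ∈ S(T_k, ψ|_{T_k})(ℚ)`, `k ∈ κ`, is the family of
restrictions of some `g ∈ S(H, ψ)(ℚ)`**: with `e : C(H) ≃ₐ Π_k C(T_k)` the restriction isomorphism of g53-#1, the element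
`γ = e⁻¹((δ_k)_k) ∈ C(H)` satisfies `e(γ†γ) = ((e γ)_k^{†_k} (e γ)_k)_k = (δ_k†δ_k)_k = 1`, so `γ†γ = 1`, `γ` is injective hence an
automorphism, and `γ ∈ S(H)(ℚ) = {γ ∈ C(H) | γ†γ = 1}` restricts to the `δ_k`. [cite: Milne1999LefschetzClasses, §1 Prop. 1.5 (p. 644) and p. 644 L16–L18]
[cite: Lange2023AbelianVarietiesComplex, §7.2.4 Exercise (4)] -/
theorem Polarization.exists_mem_lefschetzGroup_forall_apply_eq_of_labelling (ψ : Polarization H)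
    (hirr : ∀ i, (T i).toHodgeStructure.IsIrreducible) (δ : Π k : κ, (ψ.restrict (T k)).lefschetzGroup) :
    ∃ g ∈ ψ.lefschetzGroup, ∀ (k : κ) (v : (T k).toSubmodule),
      g (v : V) = ((δ k : (T k).toSubmodule ≃ₗ[ℚ] (T k).toSubmodule) v : V) := by
  obtain ⟨e, he, hadj⟩ := ψ.exists_algEquiv_pi_centralizer_coe_apply_eq_adjoint_of_labelling T hT hc hκ hirr
  -- the family `δ` read in `Π_k C(T_k)`, and `γ = e⁻¹ δ ∈ C(H)`
  have hδ : ∀ k : κ, (((δ k : (T k).toSubmodule ≃ₗ[ℚ] (T k).toSubmodule) : Module.End ℚ (T k).toSubmodule) ∈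
      Subalgebra.centralizer ℚ (((T k).toHodgeStructure).endAlg : Set (Module.End ℚ (T k).toSubmodule))) ∧
        (ψ.restrict (T k)).adjoint ((δ k : (T k).toSubmodule ≃ₗ[ℚ] (T k).toSubmodule) : Module.End ℚ (T k).toSubmodule) *
          ((δ k : (T k).toSubmodule ≃ₗ[ℚ] (T k).toSubmodule) : Module.End ℚ (T k).toSubmodule) = 1 := fun k =>
    ((ψ.restrict (T k)).mem_lefschetzGroup_iff_adjoint_mul_self_eq_one _).1 (δ k).2
  let δ' : Π k : κ, Subalgebra.centralizer ℚ (((T k).toHodgeStructure).endAlg : Set (Module.End ℚ (T k).toSubmodule)) :=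
    fun k => ⟨_, (hδ k).1⟩
  obtain ⟨γ, hγ⟩ : ∃ γ : Subalgebra.centralizer ℚ (H.endAlg : Set (Module.End ℚ V)), γ = e.symm δ' := ⟨_, rfl⟩
  have hγapply : ∀ (k : κ) (v : (T k).toSubmodule),
      (γ : Module.End ℚ V) v = ((δ k : (T k).toSubmodule ≃ₗ[ℚ] (T k).toSubmodule) v : V) := fun k v => by
    rw [hγ, HodgeStructure.coe_symm_apply_eq_of_forall_coe_apply_eq T e he δ' k v]
    rfl
  have heγ : e γ = δ' := by rw [hγ, AlgEquiv.apply_symm_apply]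
  -- `γ†γ = 1`, checked on the representatives through `e`
  have hone : (⟨ψ.adjoint γ, ψ.adjoint_mem_centralizer_endAlg γ.2⟩ : Subalgebra.centralizer ℚ (H.endAlg : Set (Module.End ℚ V))) *
      γ = 1 := by
    apply e.injective
    rw [map_mul, map_one]
    funext k
    rw [Pi.mul_apply, Pi.one_apply]
    apply Subtype.ext
    rw [MulMemClass.coe_mul, OneMemClass.coe_one, hadj γ k, heγ]
    exact (hδ k).2
  have hone' : ψ.adjoint (γ : Module.End ℚ V) * (γ : Module.End ℚ V) = 1 := by
    have h := congrArg (Subtype.val : Subalgebra.centralizer ℚ (H.endAlg : Set (Module.End ℚ V)) → Module.End ℚ V) hone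
    rwa [MulMemClass.coe_mul, OneMemClass.coe_one] at h
  -- `γ` is injective, hence an automorphism `g` of `V`, and `g ∈ S(H)(ℚ)`
  have hinj : Function.Injective (γ : Module.End ℚ V) := fun v w hvw => by
    have h := congrArg (ψ.adjoint (γ : Module.End ℚ V)) hvw
    rwa [← Module.End.mul_apply, ← Module.End.mul_apply, hone', Module.End.one_apply, Module.End.one_apply] at h
  refine ⟨LinearEquiv.ofInjectiveEndo _ hinj, (ψ.mem_lefschetzGroup_iff_adjoint_mul_self_eq_one _).2 ⟨γ.2, hone'⟩,
    fun k v => hγapply k v⟩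

/-- **MILNE'S PROPOSITION 1.5 ON `ℚ`-POINTS, CANONICAL FORM: restriction to the representatives is an isomorphism of groups
`S(H, ψ)(ℚ) ≃* Π_{k ∈ κ} S(T_k, ψ|_{T_k})(ℚ)`, `(e g)_k v = g v`**, for every isotypically labelled irreducible decomposition
`V = ⊕ᵢ Tᵢ` of a polarized finite-dimensional `ℚ`-Hodge structure («any such isogeny induces an isomorphism
`S(A₁) × ⋯ × S(A_s) → S(A)`, which is independent of the choice of the isogeny»: injective by §1, surjective by gluing).
[cite: Milne1999LefschetzClasses, §1 Prop. 1.5 (p. 644)] [cite: Lange2023AbelianVarietiesComplex, §7.2.4 Exercise (4)] -/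
theorem Polarization.exists_mulEquiv_pi_lefschetzGroup_of_labelling (ψ : Polarization H)
    (hirr : ∀ i, (T i).toHodgeStructure.IsIrreducible) :
    ∃ e : ψ.lefschetzGroup ≃* Π k : κ, (ψ.restrict (T k)).lefschetzGroup,
      ∀ (g : ψ.lefschetzGroup) (k : κ) (v : (T k).toSubmodule),
        ((e g k : (T k).toSubmodule ≃ₗ[ℚ] (T k).toSubmodule) v : V) = (g : V ≃ₗ[ℚ] V) v := by
  obtain ⟨r, hr, hinj⟩ := ψ.exists_monoidHom_pi_lefschetzGroup_of_labelling T hT hc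
  have hsurj : Function.Surjective r := fun δ => by
    obtain ⟨g, hg, hgδ⟩ := ψ.exists_mem_lefschetzGroup_forall_apply_eq_of_labelling T hT hc hκ hirr δ
    exact ⟨⟨g, hg⟩, funext fun k => Subtype.ext (LinearEquiv.ext fun v => Subtype.ext (by rw [hr]; exact hgδ k v))⟩
  exact ⟨MulEquiv.ofBijective r ⟨hinj, hsurj⟩, hr⟩

/-- **`g ∈ S(H)(ℚ)` is determined by its restrictions to the representatives, and every family `(δ_k ∈ S(T_k)(ℚ))_k` is the family
of restrictions of a unique `g ∈ S(H)(ℚ)`** (bijectivity of restriction, spelled out on `GL(V)`).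
[cite: Milne1999LefschetzClasses, §1 Prop. 1.5 (p. 644)] -/
theorem Polarization.existsUnique_mem_lefschetzGroup_forall_apply_eq (ψ : Polarization H)
    (hirr : ∀ i, (T i).toHodgeStructure.IsIrreducible) (δ : Π k : κ, (ψ.restrict (T k)).lefschetzGroup) :
    ∃! g : V ≃ₗ[ℚ] V, g ∈ ψ.lefschetzGroup ∧ ∀ (k : κ) (v : (T k).toSubmodule),
      g (v : V) = ((δ k : (T k).toSubmodule ≃ₗ[ℚ] (T k).toSubmodule) v : V) := by
  obtain ⟨e, he⟩ := ψ.exists_mulEquiv_pi_lefschetzGroup_of_labelling T hT hc hκ hirr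
  refine ⟨(e.symm δ : ψ.lefschetzGroup), ⟨(e.symm δ).2, fun k v =>
    ψ.coe_symm_apply_eq_of_forall_coe_apply_eq T e he δ k v⟩, fun g' hg' => ?_⟩
  obtain ⟨hg'S, hg'⟩ := hg'
  have h : e ⟨g', hg'S⟩ = δ :=
    funext fun k => Subtype.ext (LinearEquiv.ext fun v => Subtype.ext ((he ⟨g', hg'S⟩ k v).trans (hg' k v)))
  have h' : (⟨g', hg'S⟩ : ψ.lefschetzGroup) = e.symm δ := by
    rw [← h, MulEquiv.symm_apply_apply]
  exact congrArg Subtype.val h'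

end Labelled

end HodgeStructure

end Literature.AlgebraicGeometry.Motives
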